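import Summits.ResolutionOfSingularities.ResolutionOfSingularities.Theorems.FrobeniusClosingPatchingRelPerfectDepthOneTargets
import Literature.AlgebraicGeometry.Resolution.ColonIdealSheafFG
import Literature.AlgebraicGeometry.Resolution.HypersurfaceRestrictionTransform
import HarnessLib

/-!
# Crux `PatchingRelPerfect` (stmt-ResolutionOfSingularities-16161), chain w52 — R4 support:
# the depth-`ℓ` dictionary END at scheme level (unit branch; zero branch = descent by one layer)

[OURS · L1 W5.2 · rung tool] CHAIN.md v1.5 §2 / plan-1 g6 STEER 2026-08-27 (3') (the depth-`ℓ`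
dictionary: invariant `I𝒪_X = M · K` with `𝓘_E^ℓ ≤ K`, `E ↪ X` a closed immersion with effective
Cartier ideal; volunteer hand res-D-pv-055).  The depth-one end `DepthOneTargets.dictionaryEnd_holds`
(`…DepthOneTargets.lean`) has two branches; here are their depth-`ℓ` forms, fact-free and chart-free:

* `eq_top_of_ker_pow_le_of_comap_eq_top` — **unit branch**: `𝓘_E^ℓ ≤ K` (`ℓ ≠ 0`) and `K|_E = ⊤`
  force `K = ⊤` (`Supp K ⊆ Supp 𝓘_E^ℓ = E` and `E ∩ Supp K = Supp (K|_E) = ∅`), so `I𝒪_X = M` is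
  locally principal;
* `isLocallyPrincipal_mul_of_comap_eq_top` — the same for the format: `M · K` is then locally principal;
* `exists_eq_ker_mul_of_comap_eq_bot` — **zero branch = DESCENT BY ONE LAYER**: `𝓘_E` effective
  Cartier, `𝓘_E^{ℓ+1} ≤ K` and `K|_E = 0` give `K = 𝓘_E · K₁` with `𝓘_E^ℓ ≤ K₁` (`K₁ = (K : 𝓘_E)`,
  `pow_mul_colon_eq_of_le_of_isEffectiveCartier`, Cartier cancellation
  `IsEffectiveCartier.le_of_mul_le_mul`), i.e. `M · K = (M · 𝓘_E) · K₁` is a depth-`ℓ` state — the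
  move `a ↦ a + 1` of the coefficient filtration `{(𝔟_a, ℓ - a)}` when `𝔟_a = 0`.

Nothing here is a statement of the manuscript under review.

## References

* U. Görtz, T. Wedhorn, *Algebraic Geometry I*, 2nd ed. (2020), (13.19) p. 414, Prop. 13.91 (1).
  [GortzWedhorn2020]
* E. Bierstone, D. Grigoriev, P. Milman, J. Włodarczyk, *Effective Hironaka resolution and its
  complexity*, Asian J. Math. 15 (2011), §3.2 Lemma 3.2.1. [BierstoneGrigorievMilmanWlodarczyk2011]
-/

-- `Summit.<Summit>.<Sub>.Theorems` with `Sub = Summit` (single-conjunct summit, D-0017)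
set_option linter.dupNamespace false

noncomputable section

open CategoryTheory CategoryTheory.Limits AlgebraicGeometry Literature.AlgebraicGeometry.Resolution
open IsLocalRing TopologicalSpace

namespace Summit.ResolutionOfSingularities.ResolutionOfSingularities.Theorems

namespace DepthOne

universe u

variable {E X : Scheme.{u}} (i : E ⟶ X) [IsClosedImmersion i]

/-- **Depth-`ℓ` END, unit branch**: for a closed immersion `i : E ⟶ X`, if `𝓘_E^ℓ ≤ K` (`ℓ ≠ 0`)
and `K|_E = ⊤` then `K = ⊤` (`Supp K ⊆ E` and `E ∩ Supp K = ∅`). [cite: GortzWedhorn2020, (13.19) p. 414] -/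
theorem eq_top_of_ker_pow_le_of_comap_eq_top {K : X.IdealSheafData} {ℓ : ℕ} (hℓ : ℓ ≠ 0)
    (hK : i.ker ^ ℓ ≤ K) (hKi : K.comap i = ⊤) : K = ⊤ := by
  rw [← Scheme.IdealSheafData.support_eq_bot_iff, eq_bot_iff]
  intro x hx
  have hx' : x ∈ ((i.ker ^ ℓ).support : Set X) := Scheme.IdealSheafData.support_antitone hK hx
  rw [Scheme.IdealSheafData.support_pow _ _ hℓ, Scheme.Hom.support_ker,
    i.isClosedEmbedding.isClosed_range.closure_eq] at hx'
  obtain ⟨e, rfl⟩ := hx'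
  have he : e ∈ ((K.comap i).support : Set E) := by
    rw [Scheme.IdealSheafData.support_comap]
    exact hx
  rw [hKi, Scheme.IdealSheafData.support_top] at he
  exact he

/-- **Depth-`ℓ` END, unit branch, for the FORMAT**: with `M` effective Cartier, `𝓘_E^ℓ ≤ K` (`ℓ ≠ 0`)
and `K|_E = ⊤`, the ideal `M · K = M` is locally principal. [cite: GortzWedhorn2020, (13.19) p. 414] -/
theorem isLocallyPrincipal_mul_of_comap_eq_top {M K : X.IdealSheafData} (hM : IsEffectiveCartier M)
    {ℓ : ℕ} (hℓ : ℓ ≠ 0) (hK : i.ker ^ ℓ ≤ K) (hKi : K.comap i = ⊤) : IsLocallyPrincipal (M * K) := by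
  rw [eq_top_of_ker_pow_le_of_comap_eq_top i hℓ hK hKi, Scheme.IdealSheafData.mul_top]
  exact hM.isLocallyPrincipal

omit [IsClosedImmersion i] in
/-- **Depth-`ℓ` END, zero branch = DESCENT by one layer**: if `𝓘_E` is an effective Cartier divisor,
`𝓘_E^{ℓ+1} ≤ K` and `K|_E = 0`, then `K = 𝓘_E · K₁` with `K₁ = (K : 𝓘_E)` and `𝓘_E^ℓ ≤ K₁`
(so `M · K = (M · 𝓘_E) · K₁` is a depth-`ℓ` state).
[cite: BierstoneGrigorievMilmanWlodarczyk2011, §3.2 Lemma 3.2.1] [cite: GortzWedhorn2020, Prop. 13.91 (1)] -/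
theorem exists_eq_ker_mul_of_comap_eq_bot (hiE : IsEffectiveCartier i.ker) {K : X.IdealSheafData}
    {ℓ : ℕ} (hK : i.ker ^ (ℓ + 1) ≤ K) (hKi : K.comap i = ⊥) :
    ∃ K₁ : X.IdealSheafData, K = i.ker * K₁ ∧ i.ker ^ ℓ ≤ K₁ := by
  have hKle : K ≤ i.ker := (DepthOneTargets.comap_eq_bot_iff_le_ker' K i).mp hKi
  have hKle' : K ≤ i.ker ^ 1 := by rwa [pow_one]
  have h : i.ker * colon K i.ker = K := by
    have h1 := pow_mul_colon_eq_of_le_of_isEffectiveCartier hiE hKle'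
    simp only [pow_one] at h1
    exact h1
  refine ⟨colon K i.ker, h.symm, ?_⟩
  apply IsEffectiveCartier.le_of_mul_le_mul hiE
  rw [h, ← pow_succ']
  exact hK

end DepthOne

end Summit.ResolutionOfSingularities.ResolutionOfSingularities.Theorems

end
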